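import Mathlib.Algebra.BigOperators.Fin
import Mathlib.Data.ZMod.Basic
import Literature.Computability.QuantumComplexity.IQPForrelation

/-!
# Crux `CubicForrelation.NearExactIsExact` (stmt-QuantumAdvantage-14043) — BLOCK-DIAGONAL FRAMES `1₃ ⊕ P` on `3 + m` bits

Certificate seat `b2b-cforr-cert` (gen 41).  HONEST FRAMING: kernel-checked bookkeeping (standard axioms; Mathlib + the tree's bit vectors),
step (a) of HOME/b2b-cforr-cert-g41/ASSEMBLY-BLUEPRINT-W8.md: a frame `P` on the `S`-block (…CubicFormLightCoords `tlc_coords`, on `Fin 9`)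
lifts to the frame `1₃ ⊕ P` on `Fin (3 + 9)` of the adapted R2 coordinates (…CubicFormCells), acting by `(v, s) ↦ (v, P·s)` — so the cells
of `κ' ∘ (1 ⊕ P)` are the cells of `κ'` composed with `P`, the `y`-block (and `hD`) is untouched, and …CubicFormTransport applies with
this matrix.  Nothing about `θ₁₂`; NOT summit progress.

* `tbf_block_frame`: for an inverse pair `P, Pi` on `Fin m` there is an inverse pair `L, Li` on `Fin (3 + m)` with
  `L·(Fin.append v s) = Fin.append v (P·s)` and `Li·(Fin.append v s) = Fin.append v (Pi·s)` (bit-vector action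
  `(M·y)_ψ = [Σ_φ M_{ψφ} y_φ = 1]`), and the block entries.

References: folklore.  Axioms: the standard three.
-/

set_option linter.dupNamespace false -- D-0017: single-problem summit ⇒ `QuantumAdvantage.QuantumAdvantage` by design

namespace Summit.QuantumAdvantage.QuantumAdvantage.Theorems.CubicForrelation.NearExactIsExact

open Finset
open Literature.Computability.QuantumComplexity.BuzetChailloux (bxor zeroVec)

variable {m : ℕ}

/-- **Block-diagonal lift of a frame.**  See the module docstring. [folklore] -/
theorem tbf_block_frame (P Pi : Fin m → Fin m → ZMod 2)
    (hPPi : ∀ ψ ω, (∑ φ, P ψ φ * Pi φ ω) = if ψ = ω then 1 else 0)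
    (hPiP : ∀ ψ ω, (∑ φ, Pi ψ φ * P φ ω) = if ψ = ω then 1 else 0) :
    ∃ L Li : Fin (3 + m) → Fin (3 + m) → ZMod 2,
      (∀ ψ ω, (∑ φ, L ψ φ * Li φ ω) = if ψ = ω then 1 else 0) ∧
      (∀ ψ ω, (∑ φ, Li ψ φ * L φ ω) = if ψ = ω then 1 else 0) ∧
      (∀ (v : Fin 3 → Bool) (s : Fin m → Bool),
        (fun ψ => decide ((∑ φ, L ψ φ * (if Fin.append v s φ = true then (1 : ZMod 2) else 0)) = 1)) =
          Fin.append v (fun σ => decide ((∑ σ', P σ σ' * (if s σ' = true then (1 : ZMod 2) else 0)) = 1))) ∧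
      (∀ (v : Fin 3 → Bool) (s : Fin m → Bool),
        (fun ψ => decide ((∑ φ, Li ψ φ * (if Fin.append v s φ = true then (1 : ZMod 2) else 0)) = 1)) =
          Fin.append v (fun σ => decide ((∑ σ', Pi σ σ' * (if s σ' = true then (1 : ZMod 2) else 0)) = 1))) ∧
      (∀ t t', L (Fin.castAdd m t) (Fin.castAdd m t') = if t = t' then 1 else 0) ∧
      (∀ t σ, L (Fin.castAdd m t) (Fin.natAdd 3 σ) = 0) ∧ (∀ σ t, L (Fin.natAdd 3 σ) (Fin.castAdd m t) = 0) ∧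
      (∀ σ σ', L (Fin.natAdd 3 σ) (Fin.natAdd 3 σ') = P σ σ') := by
  classical
  -- the block matrices
  let blk : (Fin m → Fin m → ZMod 2) → Fin (3 + m) → Fin (3 + m) → ZMod 2 := fun M ψ φ =>
    Fin.addCases (fun t => Fin.addCases (fun t' => if t = t' then (1 : ZMod 2) else 0) (fun _ => 0) φ)
      (fun σ => Fin.addCases (fun _ => (0 : ZMod 2)) (fun σ' => M σ σ') φ) ψ
  have hb11 : ∀ M t t', blk M (Fin.castAdd m t) (Fin.castAdd m t') = if t = t' then 1 else 0 := by
    intro M t t'; simp only [blk, Fin.addCases_left]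
  have hb12 : ∀ M t σ, blk M (Fin.castAdd m t) (Fin.natAdd 3 σ) = 0 := by
    intro M t σ; simp only [blk, Fin.addCases_left, Fin.addCases_right]
  have hb21 : ∀ M σ t, blk M (Fin.natAdd 3 σ) (Fin.castAdd m t) = 0 := by
    intro M σ t; simp only [blk, Fin.addCases_left, Fin.addCases_right]
  have hb22 : ∀ M σ σ', blk M (Fin.natAdd 3 σ) (Fin.natAdd 3 σ') = M σ σ' := by
    intro M σ σ'; simp only [blk, Fin.addCases_right]
  -- products
  have hmul : ∀ (M M' : Fin m → Fin m → ZMod 2) ψ ω, (∑ φ, blk M ψ φ * blk M' φ ω) =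
      Fin.addCases (fun t => Fin.addCases (fun t' => if t = t' then (1 : ZMod 2) else 0) (fun _ => 0) ω)
        (fun σ => Fin.addCases (fun _ => (0 : ZMod 2)) (fun σ' => ∑ τ, M σ τ * M' τ σ') ω) ψ := by
    intro M M' ψ ω
    rw [Fin.sum_univ_add]
    refine Fin.addCases (fun t => ?_) (fun σ => ?_) ψ <;> refine Fin.addCases (fun t' => ?_) (fun σ' => ?_) ω
    · simp only [hb11, hb12, hb21, Fin.addCases_left, mul_zero, sum_const_zero, add_zero]
      simp only [ite_mul, one_mul, zero_mul, sum_ite_eq, mem_univ, if_true]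
    · simp only [hb11, hb12, hb22, Fin.addCases_left, Fin.addCases_right, mul_zero, zero_mul, sum_const_zero, add_zero]
    · simp only [hb21, hb22, hb11, Fin.addCases_left, Fin.addCases_right, zero_mul, sum_const_zero, zero_add, mul_zero]
    · simp only [hb21, hb22, hb12, Fin.addCases_right, zero_mul, sum_const_zero, zero_add]
  -- action on `Fin.append v s`
  have hact : ∀ (M : Fin m → Fin m → ZMod 2) (v : Fin 3 → Bool) (s : Fin m → Bool),
      (fun ψ => decide ((∑ φ, blk M ψ φ * (if Fin.append v s φ = true then (1 : ZMod 2) else 0)) = 1)) =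
        Fin.append v (fun σ => decide ((∑ σ', M σ σ' * (if s σ' = true then (1 : ZMod 2) else 0)) = 1)) := by
    intro M v s
    funext ψ
    rw [Fin.sum_univ_add]
    simp only [Fin.append_left, Fin.append_right]
    refine Fin.addCases (fun t => ?_) (fun σ => ?_) ψ
    · simp only [hb11, hb12, Fin.append_left, zero_mul, sum_const_zero, add_zero, ite_mul, one_mul, sum_ite_eq, mem_univ, if_true]
      cases v t <;> decide
    · simp only [hb21, hb22, Fin.append_right, zero_mul, sum_const_zero, zero_add]
  refine ⟨blk P, blk Pi, fun ψ ω => ?_, fun ψ ω => ?_, hact P, hact Pi, hb11 P, hb12 P, hb21 P, hb22 P⟩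
  · rw [hmul]
    refine Fin.addCases (fun t => ?_) (fun σ => ?_) ψ <;> refine Fin.addCases (fun t' => ?_) (fun σ' => ?_) ω
    · simp only [Fin.addCases_left]
      by_cases h : t = t'
      · subst h; simp
      · rw [if_neg h, if_neg (fun e => h (Fin.castAdd_inj.mp e))]
    · simp only [Fin.addCases_left, Fin.addCases_right]
      rw [if_neg]; intro e; have := congrArg Fin.val e; simp at this; omega
    · simp only [Fin.addCases_left, Fin.addCases_right]
      rw [if_neg]; intro e; have := congrArg Fin.val e; simp at this; omega
    · simp only [Fin.addCases_right]
      rw [hPPi]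
      by_cases h : σ = σ'
      · subst h; simp
      · rw [if_neg h, if_neg (fun e => h (Fin.natAdd_inj 3 |>.mp e))]
  · rw [hmul]
    refine Fin.addCases (fun t => ?_) (fun σ => ?_) ψ <;> refine Fin.addCases (fun t' => ?_) (fun σ' => ?_) ω
    · simp only [Fin.addCases_left]
      by_cases h : t = t'
      · subst h; simp
      · rw [if_neg h, if_neg (fun e => h (Fin.castAdd_inj.mp e))]
    · simp only [Fin.addCases_left, Fin.addCases_right]
      rw [if_neg]; intro e; have := congrArg Fin.val e; simp at this; omega
    · simp only [Fin.addCases_left, Fin.addCases_right]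
      rw [if_neg]; intro e; have := congrArg Fin.val e; simp at this; omega
    · simp only [Fin.addCases_right]
      rw [hPiP]
      by_cases h : σ = σ'
      · subst h; simp
      · rw [if_neg h, if_neg (fun e => h (Fin.natAdd_inj 3 |>.mp e))]

end Summit.QuantumAdvantage.QuantumAdvantage.Theorems.CubicForrelation.NearExactIsExact
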